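import Mathlib.Algebra.MonoidAlgebra.Basic
import Mathlib.Algebra.FreeMonoid.Basic
import Mathlib.Algebra.BigOperators.Fin
import Mathlib.Data.Finset.Lattice.Fold
import Literature.Computability.Complexity.CNF
import HarnessLib

/-!
# Non-commutative IPS: clause words, the clause product and two-sided representations

Statement-level vocabulary of the *non-commutative ideal proof system* of Li–Tzameret–Wang
[LiTzameretWang2018, Def. 1.2, Def. 1.3, Def. 1.6] over the free associative algebra
`R⟨x_i : i ∈ ν⟩`, realised as Mathlib's `MonoidAlgebra R (FreeMonoid ν)` (words = `FreeMonoid ν`,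
cf. `FreeAlgebra.equivMonoidAlgebraFreeMonoid`):

* `NCIPS.X R i` — the letter `x_i`;
* `NCIPS.litWord R l` — the arithmetisation `tr′` of a literal: the positive literal `(i, true)` goes to
  `1 - x_i`, the negative literal `(i, false)` to `x_i`, so that at a `0/1` point (`1` = true) the value is
  `1` iff the literal is FALSIFIED [LiTzameretWang2018, Def. 1.3 (`tr`), Def. 1.6 (`Q`)] — LTW write
  `tr(x_i) := x_i` with the opposite convention `0` = true; the two differ by the involution `x_i ↦ 1 - x_i`
  of `R⟨x⟩`, which fixes the Boolean/commutator ideal, so every statement below is insensitive to the choice;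
* `NCIPS.clauseWord R κ = ∏_{l ∈ κ} litWord R l` in the WRITTEN order of the clause (a `Clause ν` is a
  `List`) [LiTzameretWang2018, Def. 1.6: `Q_i := ∏_{j} tr′(ℓ_j)`];
* `NCIPS.clauseProduct R φ = ∏_{κ ∈ φ} (1 - clauseWord R κ)` in the written order of the clauses: the
  polynomial computed by `1 - tr(φ)` for the CNF `φ = κ₁ ∧ … ∧ κ_m` read as a Boolean formula
  [LiTzameretWang2018, Def. 1.3: `tr(T₁ ∧ T₂) = 1 - (1 - tr T₁)(1 - tr T₂)`, `tr(T₁ ∨ T₂) = tr T₁ · tr T₂`];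
  at a `0/1` point it is `1` iff the point satisfies `φ`, so `φ` is unsatisfiable iff `clauseProduct R φ`
  lies in the two-sided ideal generated by the axioms below (the Boolean/commutator axioms are a
  Gröbner–Shirshov basis with the increasing words normal; NOT proved here);
* `NCIPS.IsAxiom g` — `g` is a Boolean axiom `x_i x_i - x_i` or a commutator axiom `x_i x_j - x_j x_i`
  (`i ≠ j`) [LiTzameretWang2018, Def. 1.2] (LTW's Boolean axiom is `x_i (1 - x_i)`, the negative of ours;
  signs are absorbed by the cofactors everywhere below);
* `NCIPS.wordDeg p` — the degree of a non-commutative polynomial: the maximal length of a word in its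
  support (`0` for `p = 0`) [folklore; the pattern `p.coeff.support.sup FreeMonoid.length`];
* `NCIPS.HasBoundedRepr R E r φ` — the clause product is a sum of AT MOST `r` SINGLE TERMS
  `u_ρ · g_ρ · v_ρ` with `g_ρ` an axiom and cofactors `u_ρ, v_ρ ∈ R⟨x⟩` of degree `≤ E` (arbitrary
  otherwise: any number of monomials, any coefficients). The least such `r` is the two-sided *generation
  length* (the "number of lines" of an ideal-membership witness of `clauseProduct R φ` w.r.t. the
  Boolean and commutator axioms at cofactor degree `E`); a non-commutative IPS certificate written as a
  formula of size `s` yields such a representation with `r, E ≤ poly(s, |φ|)` (routes use this as a crux,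
  it is NOT asserted here). [LiTzameretWang2018, Def. 1.2 (certificate `F(x̄, ȳ)` with `F(x̄, 0) = 0`,
  `F(x̄, F̄) = 1`; §1.3.3)]

Design: `ν` (variables) and `R` (a commutative ring of coefficients) are arbitrary; routes take `ν = Fin n`,
`R = ℚ` or `ZMod q`. Deliberately NOT here: non-commutative formulas / algebraic branching programs and
their size (LTW Def. 2.3–2.5), the NC-IPS refutation-as-formula and Theorems 1.4/1.7 (named facts for a
later file), the Gröbner–Shirshov normal form.
-/

namespace Literature.Computability.MetaComplexity

namespace NCIPS

open Literature.Computability.Complexity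

noncomputable section

universe u v

variable (R : Type u) [CommRing R] {ν : Type v}

/-- The letter `x_i` of the free associative algebra `R⟨x_i : i ∈ ν⟩ = MonoidAlgebra R (FreeMonoid ν)`.
[cite: LiTzameretWang2018, §1.3.2 (non-commutative polynomials)] -/
def X (i : ν) : MonoidAlgebra R (FreeMonoid ν) :=
  MonoidAlgebra.of R (FreeMonoid ν) (FreeMonoid.of i)

/-- Arithmetisation of a literal (`1` = true at `0/1` points): the positive literal `(i, true)` ↦ `1 - x_i`,
the negative literal `(i, false)` ↦ `x_i`; the value at a `0/1` point is `1` iff the literal is falsified.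
[cite: LiTzameretWang2018, Def. 1.3 and Def. 1.6 (tr′, up to the involution x ↦ 1 - x)] -/
def litWord (l : Literal ν) : MonoidAlgebra R (FreeMonoid ν) :=
  if l.2 then 1 - X R l.1 else X R l.1

/-- The clause word `Q_κ = ∏_{l ∈ κ} tr′(l)`, literals multiplied in their written order; at a `0/1` point it
is `1` iff the point falsifies the clause. [cite: LiTzameretWang2018, Def. 1.6] -/
def clauseWord (κ : Clause ν) : MonoidAlgebra R (FreeMonoid ν) :=
  (κ.map (litWord R)).prod

/-- The clause product `P_φ = ∏_{κ ∈ φ} (1 - Q_κ)`, clauses multiplied in their written order: the polynomial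
computed by `1 - tr(φ)` for the conjunction `φ` of its clauses; at a `0/1` point it is `1` iff the point
satisfies `φ`. [cite: LiTzameretWang2018, Def. 1.3 (tr of a conjunction) with Def. 1.6] -/
def clauseProduct (φ : CNF ν) : MonoidAlgebra R (FreeMonoid ν) :=
  (φ.map fun κ => 1 - clauseWord R κ).prod

variable {R}

/-- `g` is one of the axioms of non-commutative IPS: a Boolean axiom `x_i x_i - x_i` or a commutator axiom
`x_i x_j - x_j x_i` with `i ≠ j`. [cite: LiTzameretWang2018, Def. 1.2 (Boolean axiom, Commutator axiom)] -/
def IsAxiom (g : MonoidAlgebra R (FreeMonoid ν)) : Prop :=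
  (∃ i : ν, g = X R i * X R i - X R i) ∨ (∃ i j : ν, i ≠ j ∧ g = X R i * X R j - X R j * X R i)

/-- The degree of a non-commutative polynomial: the maximal length of a word in its support (`0` for the zero
polynomial and for constants). [folklore] -/
def wordDeg (p : MonoidAlgebra R (FreeMonoid ν)) : ℕ :=
  p.coeff.support.sup FreeMonoid.length

variable (R)

/-- `HasBoundedRepr R E r φ`: the clause product `P_φ` is a sum of at most `r` single terms `u_ρ · g_ρ · v_ρ`
(`ρ < r`; unused terms may be taken `0`) with every `g_ρ` a Boolean or commutator axiom and cofactors of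
degree `wordDeg u_ρ, wordDeg v_ρ ≤ E` but otherwise arbitrary. The least such `r` is the two-sided generation
length of `P_φ` at cofactor degree `E` (`∞` if none), the coefficient-blind shadow of a non-commutative IPS
certificate. [cite: LiTzameretWang2018, Def. 1.2 and §1.3.3 (ideal membership witnessed through the Boolean and commutator axioms)] -/
def HasBoundedRepr (E r : ℕ) (φ : CNF ν) : Prop :=
  ∃ u g v : Fin r → MonoidAlgebra R (FreeMonoid ν),
    (∀ ρ, IsAxiom (g ρ) ∧ wordDeg (u ρ) ≤ E ∧ wordDeg (v ρ) ≤ E) ∧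
      ∑ ρ, u ρ * g ρ * v ρ = clauseProduct R φ

/-! ### Unfolding lemmas -/

/-- The empty clause has clause word `1` (so `1 - Q_∅ = 0`: a CNF containing the empty clause has `P_φ = 0`).
[cite: LiTzameretWang2018, Def. 1.6] -/
@[simp] theorem clauseWord_nil : clauseWord R ([] : Clause ν) = 1 := by
  simp [clauseWord]

/-- Unfolding the clause word on a cons. [cite: LiTzameretWang2018, Def. 1.6] -/
@[simp] theorem clauseWord_cons (l : Literal ν) (κ : Clause ν) :
    clauseWord R (l :: κ) = litWord R l * clauseWord R κ := by
  simp [clauseWord]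

/-- The empty CNF has clause product `1`. [cite: LiTzameretWang2018, Def. 1.3] -/
@[simp] theorem clauseProduct_nil : clauseProduct R ([] : CNF ν) = 1 := by
  simp [clauseProduct]

/-- Unfolding the clause product on a cons. [cite: LiTzameretWang2018, Def. 1.3] -/
@[simp] theorem clauseProduct_cons (κ : Clause ν) (φ : CNF ν) :
    clauseProduct R (κ :: φ) = (1 - clauseWord R κ) * clauseProduct R φ := by
  simp [clauseProduct]

/-- A CNF containing the empty clause has clause product `0` (and is unsatisfiable,
`CNF.not_satisfiable_of_nil_mem`). [cite: LiTzameretWang2018, Def. 1.3 with Def. 1.6] -/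
theorem clauseProduct_eq_zero_of_nil_mem {φ : CNF ν} (h : ([] : Clause ν) ∈ φ) :
    clauseProduct R φ = 0 := by
  unfold clauseProduct
  apply List.prod_eq_zero
  exact List.mem_map.2 ⟨[], h, by simp⟩

/-! ### Values at `0/1` points (the translation is faithful) -/

/-- Evaluation of a non-commutative polynomial at the `0/1` point of an assignment `σ` (`true ↦ 1`,
`false ↦ 0`), i.e. the composite `R⟨x⟩ → R[x]/(x_i² - x_i) → R` at `σ`. [folklore] -/
def boolEval (σ : ν → Bool) : MonoidAlgebra R (FreeMonoid ν) →ₐ[R] R :=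
  MonoidAlgebra.lift R R (FreeMonoid ν) (FreeMonoid.lift fun i => if σ i then (1 : R) else 0)

/-- The letter `x_i` evaluates to `1`/`0` according to `σ i`. [folklore] -/
@[simp] theorem boolEval_X (σ : ν → Bool) (i : ν) :
    boolEval R σ (X R i) = if σ i then 1 else 0 := by
  unfold boolEval X
  rw [MonoidAlgebra.lift_of]
  simp

/-- A literal's word evaluates to `0` at points satisfying the literal and to `1` at points falsifying it.
[cite: LiTzameretWang2018, Def. 1.3 ("T is a tautology iff tr(T) = 0 for every 0-1 assignment")] -/
theorem boolEval_litWord (σ : ν → Bool) (l : Literal ν) :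
    boolEval R σ (litWord R l) = if l.eval σ then 0 else 1 := by
  rcases l with ⟨i, b⟩
  cases b <;> cases h : σ i <;> simp [litWord, Literal.eval, h]

/-- A clause word evaluates to `0` at points satisfying the clause and to `1` at points falsifying it.
[cite: LiTzameretWang2018, Def. 1.6] -/
theorem boolEval_clauseWord (σ : ν → Bool) (κ : Clause ν) :
    boolEval R σ (clauseWord R κ) = if κ.eval σ then 0 else 1 := by
  induction κ with
  | nil => simp [Clause.eval]
  | cons l κ ih =>
      have hc : Clause.eval σ (l :: κ) = (l.eval σ || Clause.eval σ κ) := rfl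
      rw [clauseWord_cons, map_mul, ih, boolEval_litWord, hc]
      cases l.eval σ <;> cases Clause.eval σ κ <;> simp

/-- The clause product evaluates to `1` at points satisfying the CNF and to `0` elsewhere; in particular
`φ` is unsatisfiable iff `clauseProduct R φ` vanishes on `{0,1}^ν` (for `R` nontrivial).
[cite: LiTzameretWang2018, Def. 1.3 with Def. 1.6] -/
theorem boolEval_clauseProduct (σ : ν → Bool) (φ : CNF ν) :
    boolEval R σ (clauseProduct R φ) = if φ.eval σ then 1 else 0 := by
  induction φ with
  | nil => simp
  | cons κ φ ih =>
      rw [clauseProduct_cons, map_mul, map_sub, map_one, ih, boolEval_clauseWord, CNF.eval_cons]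
      cases Clause.eval σ κ <;> cases CNF.eval φ σ <;> simp

/-- Soundness direction of the translation: a CNF with a bounded representation of any size is
unsatisfiable over any nontrivial `R` (evaluate both sides at a satisfying `0/1` point: every axiom
vanishes there, the clause product is `1`). [cite: LiTzameretWang2018, Def. 1.2 (soundness of IPS certificates)] -/
theorem HasBoundedRepr.not_satisfiable [Nontrivial R] {E r : ℕ} {φ : CNF ν}
    (h : HasBoundedRepr R E r φ) : ¬ φ.Satisfiable := by
  rintro ⟨σ, hσ⟩
  obtain ⟨u, g, v, hterm, hsum⟩ := h
  have hax : ∀ ρ, boolEval R σ (g ρ) = 0 := by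
    intro ρ
    rcases (hterm ρ).1 with ⟨i, hi⟩ | ⟨i, j, -, hij⟩
    · rw [hi, map_sub, map_mul, boolEval_X]
      cases σ i <;> simp
    · rw [hij, map_sub, map_mul, map_mul, boolEval_X, boolEval_X]
      exact sub_eq_zero.2 (mul_comm _ _)
  have key := congrArg (boolEval R σ) hsum
  rw [map_sum, boolEval_clauseProduct, hσ] at key
  simp only [map_mul, hax, mul_zero, zero_mul, Finset.sum_const_zero, if_true] at key
  exact zero_ne_one key

end

end NCIPS

end Literature.Computability.MetaComplexity
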